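import Literature.NumberTheory.PAdicHodge.AinfAdicComplete
import Literature.NumberTheory.PAdicHodge.FontaineThetaGalois
import Literature.NumberTheory.GaloisRepresentations.LubinTateComparisonPoints
import Mathlib.RingTheory.AdicCompletion.Topology
import Mathlib.Topology.Algebra.Nonarchimedean.AdicTopology
import HarnessLib

/-!
# `𝔸_inf(F)` as a topological ring: the `(p, ξ)`-adic topology, continuity of `θ` and of `Γ_F`,
# and the nil ideal `𝔫 = θ⁻¹(𝔪_{ℂ_F})`

Topic `Literature/NumberTheory/PAdicHodge`. Sequel of `AinfAdicComplete` (`𝔸_inf(F)` is `(p, ξ)`-adically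
complete and separated). This file packages that algebraic statement as the ANALYTIC structure used by
Fontaine's and Colmez's constructions of `p`-adic periods of formal groups (Fontaine 1977 Ch. V; Colmez 1992
§1–§2; sequel `AinfFormalGroupPoints`): a complete Hausdorff linearly topologised ring on which integral power
series can be evaluated at the topologically nilpotent elements `𝔫 = θ⁻¹(𝔪_{ℂ_F})`.

* §1 `AinfTop F p` — the type synonym of `𝔸_inf(F) = 𝕎(𝒪_{ℂ_F}♭)` carrying the `(p, ξ)`-adic topology
  (Mathlib `WithIdeal`; Fontaine 1994 Exp. II §1.3.1: «on munit `A_inf` de la topologie `(p, [ϖ])`-adique»,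
  which is the `(p, ξ)`-adic one, tree `span_p_xi_eq`). It is a complete, Hausdorff, linearly topologised
  commutative topological ring (`CompleteSpace`, `T2Space` from `isAdicComplete_span_p_xi`); ideals
  containing a power of `(p, ξ)` are open and closed; an element with a power in `(p, ξ)` is topologically
  nilpotent.
* §2 `AinfTop.theta` — Fontaine's `θ : 𝔸_inf → 𝒪_{ℂ_F}` as a CONTINUOUS ring homomorphism to the closed unit
  ball `CBall F = 𝒪_{ℂ_F}` of `ℂ_F` (`θ((p, ξ)ⁿ) ⊆ pⁿ𝒪_{ℂ_F}`), and `AinfTop.gal σ` — the action of `σ ∈ Γ_F`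
  (tree `galAinf`) as a continuous ring endomorphism (`σ(p, ξ) = (p, ξ)` since `σ(ker θ) = ker θ`).
* §3 `AinfTop.nilTheta` — the closed ideal `𝔫 = θ⁻¹(𝔪_{ℂ_F}) = {a : ‖θ(a)‖ < 1}` of topologically nilpotent
  elements (tree `exists_pow_mem_span_p_xi_of_norm_lt_one`), as a `LubinTate.NilIdeal` (the domain of
  tree `LubinTate.evalPt` / `addPt`); `(p, ξ) ⊆ 𝔫`, `θ : 𝔫 → 𝔪_{ℂ_F}` onto, `𝔫` is `Γ_F`-stable.

Definitions (reviewed): `AinfTop`, `AinfTop.of`, `integerCEquivCBall`, `AinfTop.theta`, `AinfTop.gal`,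
`AinfTop.nilTheta`. No named facts, no `sorry`. This is infrastructure for the supersingular sector of
`isDeRham_restrictedRationalTateRep` (hDR); nothing about elliptic curves is proved here.

## References
* J.-M. Fontaine, *Le corps des périodes p-adiques*, Astérisque 223 (1994), Exp. II §1.3 (topology of
  `A_inf`), §1.2 (`θ`). [FontaineAsterisque223III]
* J.-M. Fontaine, Y. Ouyang, *Theory of p-adic Galois representations*, §4.4. [FontaineOuyang2022]
* J.-P. Serre, *Local class field theory* (Cassels–Fröhlich Ch. VI) §3.2: points of a formal group with
  values in a complete ring. [CasselsFrohlichANT1967]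
-/

noncomputable section

open Ideal WittVector MvPowerSeries Field

namespace Literature.NumberTheory.PAdicHodge

open Literature.NumberTheory.GaloisRepresentations
open Literature.NumberTheory.GaloisRepresentations.IsNonarchimedeanLocalField
open Literature.NumberTheory.GaloisRepresentations.LubinTate

variable (F : Type) [Field F] [ValuativeRel F] [TopologicalSpace F] [IsNonarchimedeanLocalField F]
  (p : ℕ) [Fact p.Prime] [Fact (¬ IsUnit (p : integerC F))]

/-! ## §1 `𝔸_inf(F)` with its `(p, ξ)`-adic topology -/

/-- **`𝔸_inf(F)` as a topological ring**: the type synonym of `𝔸_inf(F) = 𝕎(𝒪_{ℂ_F}♭)` carrying the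
`(p, ξ)`-adic (= `(p, [ϖ])`-adic) topology. [cite: FontaineAsterisque223III, Exp. II §1.3.1] -/
def AinfTop : Type := Ainf (p := p) F

namespace AinfTop

/-- Ring structure (that of `𝔸_inf`). [folklore] -/
instance : CommRing (AinfTop F p) := inferInstanceAs (CommRing (Ainf (p := p) F))

/-- The preferred ideal `(p, ξ)`, giving the adic topology, uniformity and linear topology through Mathlib's
`WithIdeal`. [cite: FontaineAsterisque223III, Exp. II §1.3.1] -/
instance : WithIdeal (AinfTop F p) := ⟨(Ideal.span {(p : Ainf (p := p) F), xi} : Ideal (Ainf (p := p) F))⟩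

/-- `𝔸_inf` is a domain. [folklore] -/
instance : IsDomain (AinfTop F p) := inferInstanceAs (IsDomain (Ainf (p := p) F))

/-- The identification `𝔸_inf(F) = AinfTop F p` (identity). [folklore] -/
def of : Ainf (p := p) F ≃+* AinfTop F p := RingEquiv.refl _

/-- The defining ideal is `(p, ξ)`. [cite: FontaineAsterisque223III, Exp. II §1.3.1] -/
theorem ideal_eq : (WithIdeal.i : Ideal (AinfTop F p)) = Ideal.span {(p : AinfTop F p), of F p xi} := rfl

/-- The topology is the `(p, ξ)`-adic one. [cite: FontaineAsterisque223III, Exp. II §1.3.1] -/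
theorem isAdic : IsAdic (WithIdeal.i : Ideal (AinfTop F p)) := rfl

/-- **`𝔸_inf` is complete** for the `(p, ξ)`-adic topology. [cite: FontaineAsterisque223III, Exp. II §1.3.2] -/
instance [CharZero F] [IsAdicComplete (Ideal.span {(p : integerC F)}) (integerC F)] :
    CompleteSpace (AinfTop F p) :=
  ((isAdic F p).isAdicComplete_iff.1 (isAdicComplete_span_p_xi (F := F) (p := p))).1

/-- **`𝔸_inf` is Hausdorff** for the `(p, ξ)`-adic topology. [cite: FontaineAsterisque223III, Exp. II §1.3.2] -/
instance [CharZero F] [IsAdicComplete (Ideal.span {(p : integerC F)}) (integerC F)] :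
    T2Space (AinfTop F p) :=
  ((isAdic F p).isAdicComplete_iff.1 (isAdicComplete_span_p_xi (F := F) (p := p))).2

variable {F p}

/-- Powers of `(p, ξ)` are neighbourhoods of `0`. [cite: FontaineAsterisque223III, Exp. II §1.3.1] -/
theorem pow_mem_nhds_zero (n : ℕ) : ((WithIdeal.i ^ n : Ideal (AinfTop F p)) : Set (AinfTop F p)) ∈ nhds 0 :=
  (Ideal.hasBasis_nhds_zero_adic (WithIdeal.i : Ideal (AinfTop F p))).mem_of_mem trivial

/-- An ideal containing a power of `(p, ξ)` is open. [cite: FontaineAsterisque223III, Exp. II §1.3.1] -/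
theorem isOpen_of_pow_le {J : Ideal (AinfTop F p)} {n : ℕ} (h : WithIdeal.i ^ n ≤ J) :
    IsOpen (J : Set (AinfTop F p)) :=
  J.toAddSubgroup.isOpen_of_mem_nhds (Filter.mem_of_superset (pow_mem_nhds_zero n) h)

/-- An ideal containing a power of `(p, ξ)` is closed. [cite: FontaineAsterisque223III, Exp. II §1.3.1] -/
theorem isClosed_of_pow_le {J : Ideal (AinfTop F p)} {n : ℕ} (h : WithIdeal.i ^ n ≤ J) :
    IsClosed (J : Set (AinfTop F p)) :=
  (⟨J.toAddSubgroup, isOpen_of_pow_le h⟩ : OpenAddSubgroup (AinfTop F p)).isClosed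

/-- An element some power of which lies in `(p, ξ)` is topologically nilpotent.
[cite: FontaineAsterisque223III, Exp. II §1.3] -/
theorem isTopologicallyNilpotent_of_pow_mem {a : AinfTop F p} {N : ℕ} (h : a ^ N ∈ (WithIdeal.i : Ideal (AinfTop F p))) :
    IsTopologicallyNilpotent a := by
  rw [IsTopologicallyNilpotent, (Ideal.hasBasis_nhds_zero_adic (WithIdeal.i : Ideal (AinfTop F p))).tendsto_right_iff]
  intro m _
  rw [Filter.eventually_atTop]
  refine ⟨N * m, fun n hn => ?_⟩
  obtain ⟨k, rfl⟩ := Nat.exists_eq_add_of_le hn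
  change a ^ (N * m + k) ∈ (WithIdeal.i ^ m : Ideal (AinfTop F p))
  rw [pow_add, pow_mul]
  exact Ideal.mul_mem_right _ _ (Ideal.pow_mem_pow h m)

end AinfTop

/-! ## §2 `θ` and the `Γ_F`-action as continuous ring homomorphisms -/

variable [IsAdicComplete (Ideal.span {(p : integerC F)}) (integerC F)]

variable {F} in
omit [IsAdicComplete (Ideal.span {(p : integerC F)}) (integerC F)] in
/-- `𝒪_{ℂ_F}` (tree `integerC F`, carrier `{‖x‖ ≤ 1}`) identified with the closed unit ball `CBall F` of the
Lubin–Tate files (Mathlib's valuation subring of the norm valuation): the identity on elements.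
[folklore] -/
def integerCEquivCBall : integerC F ≃+* CBall F :=
  RingEquiv.subringCongr (Subring.ext fun x => by rw [mem_integerC_iff, LubinTate.mem_unitBall_iff])

variable {F} in
omit [IsAdicComplete (Ideal.span {(p : integerC F)}) (integerC F)] in
/-- `integerCEquivCBall` is the identity on `ℂ_F`. [cite: FontaineOuyang2022, §3.1] -/
@[simp] theorem coe_integerCEquivCBall (x : integerC F) :
    ((integerCEquivCBall x : CBall F) : CompletedAlgClosure F) = (x : CompletedAlgClosure F) := rfl

namespace AinfTop

/-- **Fontaine's `θ : 𝔸_inf(F) → 𝒪_{ℂ_F}`** on the topological ring `AinfTop F p`, valued in the closed unit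
ball `CBall F` of `ℂ_F`. [cite: FontaineAsterisque223III, Exp. II §1.2.2] -/
def theta : AinfTop F p →+* CBall F :=
  (integerCEquivCBall (F := F)).toRingHom.comp ((fontaineTheta (integerC F) p).comp (of F p).symm.toRingHom)

variable {F p}

/-- Unfolding `theta` in `ℂ_F`. [cite: FontaineAsterisque223III, Exp. II §1.2.2] -/
theorem coe_theta (a : Ainf (p := p) F) :
    ((theta F p (of F p a) : CBall F) : CompletedAlgClosure F) = (fontaineTheta (integerC F) p a : integerC F) := rfl

/-- `θ(p) = p` and `θ(ξ) = 0`: `θ` maps `(p, ξ)` into `p·𝒪_{ℂ_F}`, hence `(p, ξ)ⁿ` into `pⁿ𝒪_{ℂ_F}`.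
[cite: FontaineAsterisque223III, Exp. II §1.2.2] -/
theorem theta_mem_span_pow_of_mem_pow {n : ℕ} {a : AinfTop F p} (ha : a ∈ (WithIdeal.i ^ n : Ideal (AinfTop F p))) :
    theta F p a ∈ Ideal.span {(p : CBall F)} ^ n := by
  have hmap : (WithIdeal.i : Ideal (AinfTop F p)).map (theta F p) ≤ Ideal.span {(p : CBall F)} := by
    rw [ideal_eq, Ideal.map_span, Ideal.span_le]
    rintro _ ⟨y, hy, rfl⟩
    simp only [Set.mem_insert_iff, Set.mem_singleton_iff] at hy
    rcases hy with rfl | rfl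
    · rw [map_natCast]; exact Ideal.subset_span rfl
    · have h0 : theta F p (of F p xi) = 0 := by
        apply Subtype.ext
        rw [coe_theta, fontaineTheta_xi]; rfl
      rw [SetLike.mem_coe, h0]; exact Submodule.zero_mem _
  have h := Ideal.mem_map_of_mem (theta F p) ha
  rw [Ideal.map_pow] at h
  exact Ideal.pow_right_mono hmap n h

/-- `‖θ(a)‖ ≤ ‖p‖ⁿ` for `a ∈ (p, ξ)ⁿ`. [cite: FontaineAsterisque223III, Exp. II §1.2.2] -/
theorem norm_theta_le_of_mem_pow {n : ℕ} {a : AinfTop F p} (ha : a ∈ (WithIdeal.i ^ n : Ideal (AinfTop F p))) :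
    ‖((theta F p a : CBall F) : CompletedAlgClosure F)‖ ≤ ‖(p : CompletedAlgClosure F)‖ ^ n := by
  have h := theta_mem_span_pow_of_mem_pow ha
  rw [Ideal.span_singleton_pow, Ideal.mem_span_singleton'] at h
  obtain ⟨b, hb⟩ := h
  rw [← hb, Subring.coe_mul, SubmonoidClass.coe_pow, norm_mul, norm_pow]
  have hb1 : ‖(b : CompletedAlgClosure F)‖ ≤ 1 := (LubinTate.mem_unitBall_iff _).1 b.2
  calc ‖(b : CompletedAlgClosure F)‖ * ‖((p : CBall F) : CompletedAlgClosure F)‖ ^ n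
      ≤ 1 * ‖((p : CBall F) : CompletedAlgClosure F)‖ ^ n := by gcongr
    _ = ‖(p : CompletedAlgClosure F)‖ ^ n := by rw [one_mul]; norm_cast

/-- **`θ` is continuous** for the `(p, ξ)`-adic topology on `𝔸_inf` and the norm topology on `𝒪_{ℂ_F}`.
[cite: FontaineAsterisque223III, Exp. II §1.3] -/
theorem continuous_theta : Continuous (theta F p) := by
  have hp1 : ‖(p : CompletedAlgClosure F)‖ < 1 := norm_natCast_C_lt_one'
  refine continuous_of_continuousAt_zero (theta F p) ?_
  rw [ContinuousAt, map_zero, (Ideal.hasBasis_nhds_zero_adic (WithIdeal.i : Ideal (AinfTop F p))).tendsto_iff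
    Metric.nhds_basis_ball]
  intro ε hε
  obtain ⟨n, hn⟩ := exists_pow_lt_of_lt_one hε hp1
  refine ⟨n, trivial, fun a ha => ?_⟩
  rw [Metric.mem_ball, dist_zero_right]
  exact (norm_theta_le_of_mem_pow ha).trans_lt hn

/-- `θ` is surjective on `AinfTop` as soon as Fontaine's `θ` is (tree `surjective_fontaineTheta_integerC`).
[cite: FontaineAsterisque223III, Exp. II §1.2.2] -/
theorem theta_surjective (hθ : Function.Surjective (fontaineTheta (integerC F) p)) :
    Function.Surjective (theta F p) := fun y => by
  obtain ⟨a, ha⟩ := hθ ((integerCEquivCBall (F := F)).symm y)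
  exact ⟨of F p a, by rw [theta, RingHom.comp_apply, RingHom.comp_apply]; simp [ha]⟩

variable (F p) in
/-- **The action of `σ ∈ Γ_F` on `𝔸_inf`** (`𝕎(σ♭)`, tree `galAinf`) on the topological ring `AinfTop F p`.
[cite: FontaineAsterisque223III, Exp. II §1.2] -/
def gal (σ : absoluteGaloisGroup F) : AinfTop F p →+* AinfTop F p :=
  (of F p).toRingHom.comp ((galAinf σ).comp (of F p).symm.toRingHom)

omit [IsAdicComplete (Ideal.span {(p : integerC F)}) (integerC F)] in
/-- Unfolding `gal`. [cite: FontaineAsterisque223III, Exp. II §1.2] -/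
theorem gal_of (σ : absoluteGaloisGroup F) (a : Ainf (p := p) F) : gal F p σ (of F p a) = of F p (galAinf σ a) := rfl

variable [CharZero F]

/-- `θ ∘ σ = σ ∘ θ` on `AinfTop` (tree `fontaineTheta_galAinf`). [cite: FontaineAsterisque223III, Exp. II §1.2] -/
theorem coe_theta_gal (σ : absoluteGaloisGroup F) (a : AinfTop F p) :
    ((theta F p (gal F p σ a) : CBall F) : CompletedAlgClosure F) = σ • ((theta F p a : CBall F) : CompletedAlgClosure F) := by
  change ((fontaineTheta (integerC F) p (galAinf σ a) : integerC F) : CompletedAlgClosure F) = _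
  rw [fontaineTheta_galAinf, coe_galInt]
  rfl

/-- `σ` maps `(p, ξ)` into itself (`σ p = p`, `σ ξ ∈ ker θ = ξ𝔸_inf`). [cite: FontaineAsterisque223III, Exp. II §1.2] -/
theorem ideal_map_gal_le (σ : absoluteGaloisGroup F) :
    (WithIdeal.i : Ideal (AinfTop F p)).map (gal F p σ) ≤ WithIdeal.i := by
  rw [ideal_eq, Ideal.map_span, Ideal.span_le]
  rintro _ ⟨y, hy, rfl⟩
  simp only [Set.mem_insert_iff, Set.mem_singleton_iff] at hy
  rcases hy with rfl | rfl
  · rw [map_natCast]; exact Ideal.subset_span (by simp)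
  · rw [SetLike.mem_coe, gal_of]
    have hker : galAinf σ (xi : Ainf (p := p) F) ∈ RingHom.ker (fontaineTheta (integerC F) p) :=
      galAinf_mem_ker_fontaineTheta σ xi_mem_ker
    rw [ker_fontaineTheta_eq_span_xi, Ideal.mem_span_singleton'] at hker
    obtain ⟨c, hc⟩ := hker
    rw [← hc, map_mul]
    exact Ideal.mul_mem_left _ _ (Ideal.subset_span (by simp))

/-- **`σ` is continuous** on `AinfTop` (indeed uniformly continuous). [cite: FontaineAsterisque223III, Exp. II §1.3] -/
theorem continuous_gal (σ : absoluteGaloisGroup F) :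
    Continuous (gal F p σ) :=
  (WithIdeal.uniformContinuous_of_map_le (ideal_map_gal_le σ)).continuous

/-! ## §3 The nil ideal `𝔫 = θ⁻¹(𝔪_{ℂ_F})` -/

variable (F p) in
/-- **The ideal `𝔫 = θ⁻¹(𝔪_{ℂ_F}) = {a ∈ 𝔸_inf : ‖θ(a)‖ < 1}`** as a closed ideal of topologically nilpotent
elements of `AinfTop F p` (tree `exists_pow_mem_span_p_xi_of_norm_lt_one`): the domain of the points of formal
groups with values in `𝔸_inf`. The hypothesis is the surjectivity of `θ` (tree
`surjective_fontaineTheta_integerC`). [cite: FontaineAsterisque223III, Exp. II §1.2–§1.3]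
[cite: CasselsFrohlichANT1967, Ch. VI §3.2] -/
def nilTheta (hθ : Function.Surjective (fontaineTheta (integerC F) p)) : NilIdeal (AinfTop F p) where
  toIdeal := (maxNilIdealC F).toIdeal.comap (theta F p)
  isClosed := (maxNilIdealC F).isClosed.preimage continuous_theta
  isTopologicallyNilpotent a ha := by
    obtain ⟨N, hN⟩ := exists_pow_mem_span_p_xi_of_norm_lt_one hθ (a := (of F p).symm a) ha
    exact isTopologicallyNilpotent_of_pow_mem hN

/-- Membership in `𝔫`: `‖θ(a)‖ < 1`. [cite: FontaineAsterisque223III, Exp. II §1.2.2] -/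
theorem mem_nilTheta_iff {hθ : Function.Surjective (fontaineTheta (integerC F) p)} {a : AinfTop F p} :
    a ∈ (nilTheta F p hθ).toIdeal ↔ ‖((theta F p a : CBall F) : CompletedAlgClosure F)‖ < 1 := Iff.rfl

/-- `θ` maps `𝔫` into `𝔪_{ℂ_F}`. [cite: FontaineAsterisque223III, Exp. II §1.2.2] -/
theorem theta_mem_maxNilIdealC {hθ : Function.Surjective (fontaineTheta (integerC F) p)} {a : AinfTop F p}
    (ha : a ∈ (nilTheta F p hθ).toIdeal) :
    theta F p a ∈ (maxNilIdealC F).toIdeal := ha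

/-- `(p, ξ) ⊆ 𝔫` (`θ(p, ξ) = p𝒪_{ℂ_F}`). [cite: FontaineAsterisque223III, Exp. II §1.2.2] -/
theorem ideal_le_nilTheta {hθ : Function.Surjective (fontaineTheta (integerC F) p)} :
    (WithIdeal.i : Ideal (AinfTop F p)) ≤ (nilTheta F p hθ).toIdeal := fun a ha => by
  rw [mem_nilTheta_iff]
  have h := norm_theta_le_of_mem_pow (n := 1) (by rwa [pow_one])
  rw [pow_one] at h
  exact h.trans_lt norm_natCast_C_lt_one'

/-- **`θ : 𝔫 → 𝔪_{ℂ_F}` is onto.** [cite: FontaineAsterisque223III, Exp. II §1.2.2] -/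
theorem exists_theta_eq {hθ : Function.Surjective (fontaineTheta (integerC F) p)} (y : (maxNilIdealC F).toIdeal) :
    ∃ x : (nilTheta F p hθ).toIdeal, theta F p (x : AinfTop F p) = y := by
  obtain ⟨a, ha⟩ := theta_surjective hθ (y : CBall F)
  exact ⟨⟨a, show a ∈ (nilTheta F p hθ).toIdeal by rw [mem_nilTheta_iff, ha]; exact y.2⟩, ha⟩

/-- `𝔫` is `Γ_F`-stable (`‖θ(σ a)‖ = ‖σ θ(a)‖ = ‖θ(a)‖`). [cite: FontaineAsterisque223III, Exp. II §1.2] -/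
theorem gal_mem_nilTheta {hθ : Function.Surjective (fontaineTheta (integerC F) p)} (σ : absoluteGaloisGroup F)
    {a : AinfTop F p} (ha : a ∈ (nilTheta F p hθ).toIdeal) :
    gal F p σ a ∈ (nilTheta F p hθ).toIdeal := by
  rw [mem_nilTheta_iff, coe_theta_gal, CompletedAlgClosure.norm_smul]
  exact ha

end AinfTop

end Literature.NumberTheory.PAdicHodge

end
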